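import Mathlib
import Literature.Probability.Percolation.DiagonalStripVertexVector
import HarnessLib

/-!
# The right reflection relation of Hagendorf–Liénardy's vector (HL Prop. 3.7)

Topic `Literature/Probability/Percolation`. With Cherednik parameters `β → 0`, `β̄ → ∞`, `s = 1`
(allowed at `q³ = 1` by HL (3.23) `s⁴ = q⁶`), the right `K`-matrix of HL (3.21) is `diag(1, z²)` and
the right reflection relation (3.22) reads componentwise (HL (3.25)–(3.26)): the components whose
last spin is up are invariant under `z_L ↦ 1/z_L` (`genInv_vPsiVec_of_last_up`), and those whose
last spin is down obey **`ι_L Ψ_σ = z_L² Ψ_σ`** (**`genInv_vPsiVec_of_last_down`**). As in HL's proof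
of Case 2 it suffices, by the exchange relations, to treat the base configuration
`a* = (0, …, n'-1, L-1)`; for it the residue sum reduces to the `L - n'` assignments of the last
integration variable (**`vPsi_aStar_eq_sum`**) and the difference `z_L² Ψ_{a*} - ι_L Ψ_{a*}` becomes a
multiple of `Σ_k P(t_k)/∏_{j≠k} (t_k - t_j)` over `L - n' + 1` nodes
`t_k = z_k² + c² z_k⁻²` (`k ≥ n'`) and `t_* = z_L⁻² + c² z_L²` with `P(t) = ∏_{i<n'} (t - c (z_i² + z_i⁻²))`
of degree `n' ≤ (L - n' + 1) - 2` — HL's vanishing contour integral `∮ f = -Σ_i ∮_{φ_i(C)} f = -3 ∮ f`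
(the three involutions `w ↦ -w, q/w, -q/w` of (3.32)–(3.34) are exactly the fibres of `w ↦ t(w)`),
here concluded by Lagrange interpolation (`Lagrange.coeff_eq_sum`): **`genInv_vPsi_aStar`**.

## References

* C. Hagendorf, J. Liénardy, *The open XXZ chain at Δ = -1/2 and the boundary quantum
  Knizhnik–Zamolodchikov equations*, J. Stat. Mech. (2021) 013104, arXiv:2008.03220, §3.3,
  Prop. 3.7, (3.25)–(3.35). [HagendorfLienardy2021]
-/

noncomputable section

namespace Literature.Probability.Percolation

open Finset MvPolynomial Polynomial Literature.Probability.LatticeModels.TemperleyLieb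

variable {L n' : ℕ}

/-! ### Lagrange: the top coefficient of a low-degree polynomial vanishes -/

section LagrangeVanishing

/-- **`Σ_{i∈s} P(v_i)/∏_{j≠i} (v_i - v_j) = 0` for `deg P ≤ #s - 2`** (the coefficient of `X^{#s-1}`
of the Lagrange interpolation of `P` at the distinct nodes `v_i`). [folklore] -/
theorem sum_eval_div_prod_sub_eq_zero {F ι : Type*} [Field F] [DecidableEq ι] {s : Finset ι} {v : ι → F}
    (hvs : Set.InjOn v s) {P : F[X]} (hP : P.natDegree + 2 ≤ s.card) :
    ∑ i ∈ s, P.eval (v i) / ∏ j ∈ s.erase i, (v i - v j) = 0 := by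
  have hdeg : P.degree < s.card := lt_of_le_of_lt (Polynomial.degree_le_natDegree) (by exact_mod_cast (by omega))
  rw [← Lagrange.coeff_eq_sum hvs hdeg]
  exact Polynomial.coeff_eq_zero_of_natDegree_lt (by omega)

end LagrangeVanishing

/-! ### The variable `t(x) = x² + c² x⁻²` -/

section TVar

variable (q : ℂ)

/-- `t(x) = x² + c² x⁻²`, the invariant of the involutions `x ↦ -x`, `x ↦ c/x`. [cite: HagendorfLienardy2021, (3.32)] -/
def tOf (x : RapidityField ℂ) : RapidityField ℂ := x ^ 2 + genC ℂ q ^ 2 * (x⁻¹) ^ 2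

/-- `τ(z) = c (z² + z⁻²)`, the value of `t` at which the numerator factors of `z` vanish. [folklore] -/
def tauOf (z : RapidityField ℂ) : RapidityField ℂ := genC ℂ q * (z ^ 2 + (z⁻¹) ^ 2)

variable {q} (hq : q ^ 2 + q + 1 = 0)
include hq

/-- **`[y/x][c² x y] = -c² (t(x) - t(y))`** (`c³ = 1`). [folklore] -/
theorem qbr_mul_qbr_eq_tOf_sub {x y : RapidityField ℂ} (hx : x ≠ 0) (hy : y ≠ 0) :
    qbr (y / x) * qbr (genC ℂ q ^ 2 * x * y) = -genC ℂ q ^ 2 * (tOf q x - tOf q y) := by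
  have h3 := genC_pow_three hq
  have hc : genC ℂ q ≠ 0 := genC_ne_zero'' (ne_zero_of_quad hq)
  unfold qbr tOf
  field_simp
  linear_combination (-(x ^ 2 - y ^ 2) * (genC ℂ q ^ 3 + 1)) * h3

/-- **`[c x/z][c z x] = c² (t(x) - τ(z))`** (`c³ = 1`). [folklore] -/
theorem qbr_mul_qbr_eq_tOf_sub_tauOf {x z : RapidityField ℂ} (hx : x ≠ 0) (hz : z ≠ 0) :
    qbr (genC ℂ q * x / z) * qbr (genC ℂ q * z * x) = genC ℂ q ^ 2 * (tOf q x - tauOf q z) := by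
  have h3 := genC_pow_three hq
  have hc : genC ℂ q ≠ 0 := genC_ne_zero'' (ne_zero_of_quad hq)
  unfold qbr tOf tauOf
  field_simp
  linear_combination (genC ℂ q ^ 2 * x ^ 2 * (1 + z ^ 4) - z ^ 2 * (genC ℂ q ^ 3 + 1)) * h3

end TVar

/-! ### Nonvanishing -/

section Nonvanishing

variable {q : ℂ} (hq : q ^ 2 + q + 1 = 0)

/-- `(z_j z_k)² ≠ 1`: evaluation at `z ≡ 2`. [folklore] -/
theorem zv_mul_sq_ne_one (j k : Fin L) : (zv j * zv k) ^ 2 ≠ 1 := by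
  unfold zv genZ
  rw [← map_mul, ← map_pow, Ne, show (1 : RapidityField ℂ) = toRF ℂ 1 from (map_one _).symm]
  refine toRF_ne_of_eval (fun _ => (2 : ℂ)) ?_
  norm_num [MvPolynomial.eval_mul, MvPolynomial.eval_pow, MvPolynomial.eval_X]

/-- `[z_j z_k] ≠ 0`. [folklore] -/
theorem qbr_zv_mul_ne_zero (j k : Fin L) : qbr (zv j * zv k) ≠ 0 :=
  qbr_ne_zero_of_sq_ne_one (mul_ne_zero (zv_ne_zero _) (zv_ne_zero _)) (zv_mul_sq_ne_one j k)

include hq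

/-- `[c² z_j/z_k] ≠ 0`. [folklore] -/
theorem qbr_genC_sq_zv_div_ne_zero (j k : Fin L) : qbr (genC ℂ q ^ 2 * zv j / zv k) ≠ 0 :=
  qbr_ne_zero_of_sq_ne_one (div_ne_zero (mul_ne_zero (pow_ne_zero _ (genC_ne_zero'' (ne_zero_of_quad hq))) (zv_ne_zero _))
    (zv_ne_zero _)) (genC_pow_mul_zv_div_sq_ne_one (q_pow_four_ne_one hq) j k)

/-- `z_k² ≠ c² u²` for two rapidities (`(c u/z_k)² ≠ 1`). [folklore] -/
theorem zv_sq_ne_genC_sq_mul_sq (j k : Fin L) : zv k ^ 2 ≠ genC ℂ q ^ 2 * zv j ^ 2 := by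
  intro h
  have h1 := genC_pow_mul_zv_div_sq_ne_one (L := L) (q_sq_ne_one' hq) j k
  rw [pow_one] at h1
  apply h1
  rw [div_pow, mul_pow, ← h, div_self (pow_ne_zero _ (zv_ne_zero _))]

end Nonvanishing

/-! ### The base configuration `a* = (0, …, n'-1, L-1)` and its residue sum -/

section AStar

variable (q : ℂ)

/-- The last site. [folklore] -/
def lastSite (_hL : n' + 1 ≤ L) : Fin L := ⟨L - 1, by omega⟩

/-- Its value. [folklore] -/
@[simp] theorem lastSite_val (hL : n' + 1 ≤ L) : (lastSite hL).val = L - 1 := rfl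

/-- The site of one of the first `n'` labels. [folklore] -/
def siteOf (hL : n' + 1 ≤ L) (i : Fin n') : Fin L := Fin.castLE (Nat.le_of_succ_le hL) i

/-- Its value. [folklore] -/
@[simp] theorem siteOf_val (hL : n' + 1 ≤ L) (i : Fin n') : (siteOf hL i).val = i.val := rfl

/-- **The base configuration of HL Prop. 3.7, Case 2**: down spins at `0, …, n'-1` and at the last site.
[cite: HagendorfLienardy2021, Prop. 3.7 (Case 2)] -/
def aStar (hL : n' + 1 ≤ L) : Fin (n' + 1) → Fin L :=
  Fin.snoc (siteOf hL : Fin n' → Fin L) (lastSite hL)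

/-- The pole assignment with the last integration variable at the site `k`. [folklore] -/
def jK (hL : n' + 1 ≤ L) (k : Fin L) : Fin (n' + 1) → Fin L :=
  Fin.snoc (siteOf hL : Fin n' → Fin L) k

/-- `a*` on the first labels. [folklore] -/
@[simp] theorem aStar_castSucc (hL : n' + 1 ≤ L) (ℓ : Fin n') : aStar hL ℓ.castSucc = siteOf hL ℓ := by
  simp [aStar]
/-- `a*` on the last label. [folklore] -/
@[simp] theorem aStar_last (hL : n' + 1 ≤ L) : aStar hL (Fin.last n') = lastSite hL := by simp [aStar]
/-- `jK` on the first labels. [folklore] -/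
@[simp] theorem jK_castSucc (hL : n' + 1 ≤ L) (k : Fin L) (ℓ : Fin n') : jK hL k ℓ.castSucc = siteOf hL ℓ := by
  simp [jK]
/-- `jK` on the last label. [folklore] -/
@[simp] theorem jK_last (hL : n' + 1 ≤ L) (k : Fin L) : jK hL k (Fin.last n') = k := by simp [jK]

/-- `jK k` is injective when `k` is not among the first `n'` sites. [folklore] -/
theorem jK_injective (hL : n' + 1 ≤ L) {k : Fin L} (hk : n' ≤ k.val) : Function.Injective (jK hL k) := by
  intro a b hab
  rcases Fin.eq_castSucc_or_eq_last a with ⟨a', rfl⟩ | rfl <;> rcases Fin.eq_castSucc_or_eq_last b with ⟨b', rfl⟩ | rfl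
  · simp only [jK_castSucc] at hab
    rw [Fin.castLE_injective _ hab]
  · simp only [jK_castSucc, jK_last] at hab
    exfalso; have := congrArg Fin.val hab; simp at this; omega
  · simp only [jK_castSucc, jK_last] at hab
    exfalso; have := congrArg Fin.val hab; simp at this; omega
  · rfl

/-- `jK k` as an embedding. [folklore] -/
def jKEmb (hL : n' + 1 ≤ L) (k : Fin L) (hk : n' ≤ k.val) : Fin (n' + 1) ↪ Fin L := ⟨jK hL k, jK_injective hL hk⟩

/-- **The surviving pole assignments**: if the numerator of `a*` does not vanish at `w = z ∘ J`, then
`J` freezes the first `n'` variables at their own sites and puts the last one at a site `k ≥ n'`.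
[cite: HagendorfLienardy2021, Prop. 3.7 (Case 2)] -/
theorem eq_jK_of_vNum_ne_zero (hL : n' + 1 ≤ L) {J : Fin (n' + 1) ↪ Fin L} (hJ : vNum q zv (aStar hL) (fun ℓ => zv (J ℓ)) ≠ 0) :
    ∃ k : Fin L, n' ≤ k.val ∧ (J : Fin (n' + 1) → Fin L) = jK hL k := by
  -- the first `n'` labels sit at their own sites
  have hle : ∀ ℓ : Fin n', (J ℓ.castSucc).val ≤ ℓ.val := by
    intro ℓ
    by_contra hlt
    push Not at hlt
    apply hJ
    unfold vNum
    refine mul_eq_zero_of_right _ (mul_eq_zero_of_left ?_ _)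
    refine prod_eq_zero (mem_univ ℓ.castSucc) ?_
    unfold eT
    refine mul_eq_zero_of_left (prod_eq_zero (i := J ℓ.castSucc) ?_ ?_) _
    · simp only [mem_filter, mem_univ, true_and, aStar_castSucc, Fin.lt_def, siteOf_val]; exact hlt
    · rw [div_self (zv_ne_zero _), qbr_one]
  have hfirst : (Fin.castSuccEmb.trans J : Fin n' ↪ Fin L) = Fin.castLEEmb (by omega : n' ≤ L) :=
    embedding_eq_castLE_of_le _ _ fun ℓ => hle ℓ
  have hfirst' : ∀ ℓ : Fin n', J ℓ.castSucc = siteOf hL ℓ := fun ℓ => by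
    have := congrArg (fun f => f ℓ) (congrArg DFunLike.coe hfirst)
    exact this
  refine ⟨J (Fin.last n'), ?_, ?_⟩
  · by_contra hk
    push Not at hk
    have : J (Fin.last n') = J (Fin.castSucc ⟨(J (Fin.last n')).val, hk⟩) := by
      rw [hfirst']; exact Fin.ext rfl
    exact absurd (J.injective this) (by intro h; have := congrArg Fin.val h; simp at this; omega)
  · funext ℓ
    rcases Fin.eq_castSucc_or_eq_last ℓ with ⟨ℓ', rfl⟩ | rfl
    · rw [hfirst', jK_castSucc]
    · rw [jK_last]

/-- The sites carrying the last integration variable. [folklore] -/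
def tailSites (L n' : ℕ) : Finset (Fin L) := univ.filter fun k : Fin L => n' ≤ k.val

/-- Membership in the tail. [folklore] -/
@[simp] theorem mem_tailSites {k : Fin L} : k ∈ tailSites L n' ↔ n' ≤ k.val := by simp [tailSites]

/-- **The residue sum of the base configuration is a sum over the position of the last variable.**
[cite: HagendorfLienardy2021, Prop. 3.7 (Case 2)] -/
theorem resSum_aStar (hL : n' + 1 ≤ L) :
    resSum L (n' + 1) (vNum q zv (aStar hL)) =
      ∑ k ∈ tailSites L n', vNum q zv (aStar hL) (fun ℓ => zv (jK hL k ℓ)) * ∏ ℓ, resWeight L (jK hL k ℓ) := by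
  unfold resSum
  -- restrict the sum to the image of `k ↦ jK k`
  have himage : ∀ J : Fin (n' + 1) ↪ Fin L, J ∈ (univ : Finset (Fin (n' + 1) ↪ Fin L)) →
      J ∉ (tailSites L n').attach.image (fun k => jKEmb hL k.1 (mem_tailSites.1 k.2)) →
      vNum q zv (aStar hL) (fun ℓ => zv (J ℓ)) * ∏ ℓ, resWeight L (J ℓ) = 0 := by
    intro J _ hJ
    by_contra hne
    obtain ⟨k, hk, hJk⟩ := eq_jK_of_vNum_ne_zero q hL (left_ne_zero_of_mul hne)
    apply hJ
    refine mem_image.2 ⟨⟨k, mem_tailSites.2 hk⟩, mem_attach _ _, ?_⟩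
    refine Function.Embedding.ext fun ℓ => ?_
    change jK hL k ℓ = J ℓ
    rw [hJk]
  rw [← sum_subset (subset_univ _) himage, sum_image]
  · rw [← sum_attach (tailSites L n')]
    rfl
  · rintro ⟨k, hk⟩ _ ⟨k', hk'⟩ _ h
    have := congrArg (fun J : Fin (n' + 1) ↪ Fin L => J (Fin.last n')) h
    change jK hL k (Fin.last n') = jK hL k' (Fin.last n') at this
    rw [jK_last, jK_last] at this
    exact Subtype.ext this

end AStar

/-! ### Products over `Fin (m+1)` pairs -/

section PairsSucc

variable {M : Type*} [CommMonoid M] {m : ℕ}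

/-- The pairs of `Fin (m+1)`: those below the last index and the pairs `(i, last)`. [folklore] -/
theorem pairsLT_succ :
    pairsLT (m + 1) = (pairsLT m).map ⟨fun p => (p.1.castSucc, p.2.castSucc), fun a b h => by
        simp only [Prod.mk.injEq, Fin.castSucc_inj] at h; exact Prod.ext h.1 h.2⟩ ∪
      univ.map ⟨fun i : Fin m => (i.castSucc, Fin.last m), fun a b h => by simpa using h⟩ := by
  ext ⟨a, b⟩
  simp only [mem_pairsLT, mem_union, mem_map, Function.Embedding.coeFn_mk, Prod.mk.injEq, mem_univ, true_and]
  constructor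
  · intro hab
    rcases Fin.eq_castSucc_or_eq_last b with ⟨b', rfl⟩ | rfl
    · rcases Fin.eq_castSucc_or_eq_last a with ⟨a', rfl⟩ | rfl
      · exact Or.inl ⟨(a', b'), Fin.castSucc_lt_castSucc_iff.1 hab, rfl, rfl⟩
      · exact absurd hab (not_lt.2 (le_of_lt (Fin.castSucc_lt_last b')))
    · rcases Fin.eq_castSucc_or_eq_last a with ⟨a', rfl⟩ | rfl
      · exact Or.inr ⟨a', rfl, rfl⟩
      · exact absurd hab (lt_irrefl _)
  · rintro (⟨p, hp, rfl, rfl⟩ | ⟨i, rfl, rfl⟩)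
    · exact Fin.castSucc_lt_castSucc_iff.2 hp
    · exact Fin.castSucc_lt_last i

/-- **Product over the pairs of `Fin (m+1)`.** [folklore] -/
theorem prod_pairsLT_succ (f : Fin (m + 1) → Fin (m + 1) → M) :
    ∏ p ∈ pairsLT (m + 1), f p.1 p.2 = (∏ p ∈ pairsLT m, f p.1.castSucc p.2.castSucc) * ∏ i : Fin m, f i.castSucc (Fin.last m) := by
  rw [pairsLT_succ, prod_union, prod_map, prod_map]
  · rfl
  · rw [disjoint_left]
    rintro ⟨a, b⟩ h1 h2
    simp only [mem_map, Function.Embedding.coeFn_mk, Prod.mk.injEq, mem_univ, true_and] at h1 h2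
    obtain ⟨p, _, _, rfl⟩ := h1
    obtain ⟨i, _, hb⟩ := h2
    exact absurd hb.symm (Fin.castSucc_ne_last _)

end PairsSucc

/-! ### The terms of the base configuration: common factor and tail factor -/

section Terms

variable (q : ℂ) (hL : n' + 1 ≤ L)

/-- The first `n'` rapidities as a function on labels. [folklore] -/
def zFirst : Fin n' → RapidityField ℂ := fun i => zv (siteOf hL i)

/-- **The common factor** of all terms of `Ψ_{a*}`. [folklore] -/
def cFac : RapidityField ℂ :=
  qbr (genC ℂ q) ^ (n' + 1) * pref q (zv (L := L)) * aFac q (zFirst hL) *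
    ((∏ i : Fin n', eT q zv (siteOf hL i) (zFirst hL i) * resWeight L (siteOf hL i)) *
      ∏ i : Fin n', gFac q (zv (L := L)) (zFirst hL i))

/-- **The tail factor**: the part of the term depending on the position `k` of the last variable. [folklore] -/
def gTail (k : Fin L) : RapidityField ℂ :=
  (∏ i : Fin n', aPair q (zFirst hL i) (zv k)) * (qbr (genC ℂ q ^ 2 * zv k * zv k) * (zv k)⁻¹) *
    eT q zv (lastSite hL) (zv k) * gFac q (zv (L := L)) (zv k) * resWeight L k

/-- `A` at `(z_0, …, z_{n'-1}, z_k)`. [folklore] -/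
theorem aFac_jK (k : Fin L) :
    aFac q (fun ℓ => zv (jK hL k ℓ)) =
      aFac q (zFirst hL) * ((∏ i : Fin n', aPair q (zFirst hL i) (zv k)) * (qbr (genC ℂ q ^ 2 * zv k * zv k) * (zv k)⁻¹)) := by
  unfold aFac
  rw [prod_pairsLT_succ (fun a b => aPair q (zv (jK hL k a)) (zv (jK hL k b))), Fin.prod_univ_castSucc, Fin.prod_univ_castSucc]
  simp only [jK_castSucc, jK_last, zFirst]
  ring

/-- **Each term is the common factor times the tail factor.** [folklore] -/
theorem term_eq (k : Fin L) :
    qbr (genC ℂ q) ^ (n' + 1) * pref q (zv (L := L)) *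
        (vNum q zv (aStar hL) (fun ℓ => zv (jK hL k ℓ)) * ∏ ℓ, resWeight L (jK hL k ℓ)) =
      cFac q hL * gTail q hL k := by
  unfold vNum cFac gTail
  rw [aFac_jK, Fin.prod_univ_castSucc, Fin.prod_univ_castSucc, Fin.prod_univ_castSucc]
  simp only [jK_castSucc, jK_last, aStar_castSucc, aStar_last, zFirst, prod_mul_distrib]
  ring

/-- **`Ψ_{a*} = C · Σ_{k ≥ n'} G_k`.** [cite: HagendorfLienardy2021, Prop. 3.7 (Case 2), (3.29)] -/
theorem vPsi_aStar_eq_sum : vPsi q L (n' + 1) (aStar hL) = cFac q hL * ∑ k ∈ tailSites L n', gTail q hL k := by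
  unfold vPsi
  rw [resSum_aStar q hL, mul_sum, mul_sum]
  exact sum_congr rfl fun k _ => term_eq q hL k

end Terms

/-! ### The common factor is invariant under `z_L ↦ 1/z_L` -/

section CommonFactor

variable {q : ℂ} (hq : q ^ 2 + q + 1 = 0)
include hq

/-- **The prefactor is invariant under inverting the last rapidity** (`q³ = 1`). [cite: HagendorfLienardy2021, (3.27)] -/
theorem genInv_pref (hL : 1 ≤ L) : genInv ℂ L (pref q (zv (L := L))) = pref q (zv (L := L)) := by
  set u : Fin L := ⟨L - 1, by omega⟩ with hu
  have huL : u.val + 1 = L := by simp [hu]; omega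
  have hfix : ∀ j : Fin L, j ≠ u → genInv ℂ L (zv j) = zv j := fun j hj =>
    genInv_zv_of_ne fun h' => hj (Fin.ext (by simp [hu]; omega))
  unfold pref
  rw [map_prod]
  refine prod_congr rfl fun p hp => ?_
  have hlt : p.1 < p.2 := mem_pairsLT.1 hp
  have hp1 : p.1 ≠ u := fun h' => by rw [h', Fin.lt_def] at hlt; simp [hu] at hlt; omega
  rw [map_mul, map_qbr, map_qbr, map_div₀, map_mul, map_mul, map_mul, map_pow, genInv_genC, hfix p.1 hp1]
  by_cases hp2 : p.2 = u
  · rw [hp2, genInv_zv_last huL]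
    exact prefPair_inv hq _ _
  · rw [hfix p.2 hp2]

/-- **`G(x)` is invariant under inverting the last rapidity** when `x` is (`q³ = 1`). [folklore] -/
theorem genInv_gFac (hL : 1 ≤ L) {x : RapidityField ℂ} (hx : genInv ℂ L x = x) :
    genInv ℂ L (gFac q (zv (L := L)) x) = gFac q (zv (L := L)) x := by
  set u : Fin L := ⟨L - 1, by omega⟩ with hu
  have huL : u.val + 1 = L := by simp [hu]; omega
  have hfix : ∀ j : Fin L, j ≠ u → genInv ℂ L (zv j) = zv j := fun j hj =>
    genInv_zv_of_ne fun h' => hj (Fin.ext (by simp [hu]; omega))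
  unfold gFac
  rw [← prod_mul_distrib, ← mul_prod_erase _ _ (mem_univ u), map_inv₀, map_mul, map_prod]
  congr 2
  · rw [map_mul, map_qbr, map_qbr, map_div₀, map_mul, map_mul, map_mul, map_pow, genInv_genC, hx, genInv_zv_last huL]
    exact prefPair_inv hq _ _
  · refine prod_congr rfl fun j hj => ?_
    rw [map_mul, map_qbr, map_qbr, map_div₀, map_mul, map_mul, map_mul, map_pow, genInv_genC, hx, hfix j (ne_of_mem_erase hj)]

/-- `Ẽ_ν(z_ν) ρ(ν) = -∏_{j<ν} [c z_j/z_ν] / ∏_{j<ν} [z_j/z_ν]`. [folklore] -/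
theorem eT_mul_resWeight (ν : Fin L) :
    eT q zv ν (zv ν) * resWeight L ν =
      -(∏ i ∈ sLT L ν.val, qbr (genC ℂ q * zv i / zv ν)) * (∏ i ∈ sLT L ν.val, qbr (zv i / zv ν))⁻¹ := by
  have _ := hq
  unfold eT resWeight
  rw [prod_erase_eq_prod_lt_mul_prod_gt, filter_lt_eq_sLT]
  have hP₂ : ∏ j ∈ univ.filter (fun j => ν < j), qbr (zv j / zv ν) ≠ 0 :=
    prod_ne_zero_iff.2 fun j hj => qbr_zv_div_ne_zero (fun h => by rw [h] at hj; simp at hj)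
  field_simp

variable (hL : n' + 1 ≤ L)

omit hq in
/-- `genInv L` fixes the first `n'` rapidities. [folklore] -/
theorem genInv_zFirst (i : Fin n') : genInv ℂ L (zFirst hL i) = zFirst hL i :=
  genInv_zv_of_ne (by simp; omega)

/-- **The common factor is invariant under `z_L ↦ 1/z_L`.** [cite: HagendorfLienardy2021, Prop. 3.7 (Case 2)] -/
theorem genInv_cFac : genInv ℂ L (cFac q hL) = cFac q hL := by
  have hL1 : 1 ≤ L := by omega
  unfold cFac
  rw [map_mul, map_mul, map_mul, map_mul, map_pow, map_qbr, genInv_genC, genInv_pref hq hL1, map_prod, map_prod]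
  have hA : genInv ℂ L (aFac q (zFirst hL)) = aFac q (zFirst hL) := by
    rw [map_aFac (φ := genInv ℂ L) (genInv_genC L q)]
    congr 1; funext i; exact genInv_zFirst hL i
  rw [hA]
  congr 2
  · refine prod_congr rfl fun i _ => ?_
    rw [show zFirst hL i = zv (siteOf hL i) from rfl, eT_mul_resWeight hq, map_mul, map_neg, map_inv₀, map_prod, map_prod]
    have hfix : ∀ j ∈ sLT L (siteOf hL i).val, genInv ℂ L (zv j) = zv j := fun j hj => by
      rw [mem_sLT, siteOf_val] at hj
      exact genInv_zv_of_ne (by omega)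
    have hfi : genInv ℂ L (zv (siteOf hL i)) = zv (siteOf hL i) := genInv_zFirst hL i
    have e1 : ∏ j ∈ sLT L (siteOf hL i).val, genInv ℂ L (qbr (genC ℂ q * zv j / zv (siteOf hL i))) =
        ∏ j ∈ sLT L (siteOf hL i).val, qbr (genC ℂ q * zv j / zv (siteOf hL i)) :=
      prod_congr rfl fun j hj => by rw [map_qbr, map_div₀, map_mul, genInv_genC, hfix j hj, hfi]
    have e2 : ∏ j ∈ sLT L (siteOf hL i).val, genInv ℂ L (qbr (zv j / zv (siteOf hL i))) =
        ∏ j ∈ sLT L (siteOf hL i).val, qbr (zv j / zv (siteOf hL i)) :=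
      prod_congr rfl fun j hj => by rw [map_qbr, map_div₀, hfix j hj, hfi]
    rw [e1, e2]
  · exact prod_congr rfl fun i _ => genInv_gFac hq hL1 (genInv_zFirst hL i)

end CommonFactor

/-! ### Splitting the sites into the first `n'` and the tail -/

section SplitTail

variable {M : Type*} [CommMonoid M] (hn'L : n' ≤ L)

/-- `univ = (first n' sites) ∪ tail`. [folklore] -/
theorem univ_eq_map_union_tailSites : (univ : Finset (Fin L)) = univ.map (Fin.castLEEmb hn'L) ∪ tailSites L n' := by
  ext j
  simp only [mem_univ, mem_union, mem_map, Fin.castLEEmb_apply, true_and, mem_tailSites, true_iff]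
  by_cases hj : j.val < n'
  · exact Or.inl ⟨⟨j.val, hj⟩, Fin.ext rfl⟩
  · exact Or.inr (by omega)

/-- The two parts are disjoint. [folklore] -/
theorem disjoint_map_tailSites : Disjoint (univ.map (Fin.castLEEmb hn'L)) (tailSites L n') := by
  rw [disjoint_left]
  intro j h1 h2
  simp only [mem_map, mem_univ, Fin.castLEEmb_apply, true_and] at h1
  obtain ⟨i, rfl⟩ := h1
  rw [mem_tailSites] at h2
  simp at h2; omega

/-- `∏_j = ∏_{first} · ∏_{tail}`. [folklore] -/
theorem prod_univ_split_tail (f : Fin L → M) : ∏ j, f j = (∏ i : Fin n', f (Fin.castLE hn'L i)) * ∏ j ∈ tailSites L n', f j := by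
  rw [univ_eq_map_union_tailSites hn'L, prod_union (disjoint_map_tailSites hn'L), prod_map]; rfl

/-- `∏_{j ≠ k} = ∏_{first} · ∏_{tail, j ≠ k}` for `k` in the tail. [folklore] -/
theorem prod_erase_split_tail {k : Fin L} (hk : n' ≤ k.val) (f : Fin L → M) :
    ∏ j ∈ univ.erase k, f j = (∏ i : Fin n', f (Fin.castLE hn'L i)) * ∏ j ∈ (tailSites L n').erase k, f j := by
  have : univ.erase k = univ.map (Fin.castLEEmb hn'L) ∪ (tailSites L n').erase k := by
    rw [univ_eq_map_union_tailSites hn'L, erase_union_distrib]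
    congr 1
    rw [erase_eq_of_notMem]
    intro h
    simp only [mem_map, mem_univ, Fin.castLEEmb_apply, true_and] at h
    obtain ⟨i, rfl⟩ := h
    simp at hk; omega
  rw [this, prod_union ((disjoint_map_tailSites hn'L).mono_right (erase_subset _ _)), prod_map]; rfl

/-- The tail has `L - n'` sites. [folklore] -/
theorem card_tailSites (hn'L : n' ≤ L) : (tailSites L n').card = L - n' := by
  have h := congrArg Finset.card (univ_eq_map_union_tailSites hn'L)
  rw [card_union_of_disjoint (disjoint_map_tailSites hn'L), card_map, card_univ, card_univ, Fintype.card_fin,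
    Fintype.card_fin] at h
  omega

end SplitTail

/-! ### The tail factor after cancellation -/

section Tail

variable {q : ℂ} (hq : q ^ 2 + q + 1 = 0) (hL : n' + 1 ≤ L)

/-- The cancellation pattern of the tail factor, as an identity in a field. [folklore] -/
theorem gTail_identity {F : Type*} [Field F] {U P₁ V S₁ d z Qlt cu Srest Prest : F} (hP₁ : P₁ ≠ 0) (hS₁ : S₁ ≠ 0)
    (hd : d ≠ 0) (hz : z ≠ 0) (hQ : Qlt ≠ 0) (hcu : cu ≠ 0) (hSr : Srest ≠ 0) (hPr : Prest ≠ 0) :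
    U * P₁ * V * S₁ * (d * z⁻¹) * Qlt * (Qlt * cu * (S₁ * (d * Srest)))⁻¹ * (-(P₁ * Prest)⁻¹) =
      -(U * V) * z⁻¹ * (cu * (Prest * Srest))⁻¹ := by
  field_simp

include hq

/-- **The tail factor after cancellation**:
`G_k = -(∏_{i<n'} [c z_k/z_i][c z_i z_k]) z_k⁻¹ / ([c z_L/z_k] ∏_{j ≥ n', j ≠ k} [z_j/z_k][c² z_k z_j])`.
[cite: HagendorfLienardy2021, Prop. 3.7 (Case 2), (3.31)] -/
theorem gTail_eq {k : Fin L} (hk : n' ≤ k.val) :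
    gTail q hL k = -(∏ i : Fin n', qbr (genC ℂ q * zv k / zFirst hL i) * qbr (genC ℂ q * zFirst hL i * zv k)) * (zv k)⁻¹ *
      (qbr (genC ℂ q * zv (lastSite hL) / zv k) *
        ∏ j ∈ (tailSites L n').erase k, qbr (zv j / zv k) * qbr (genC ℂ q ^ 2 * zv k * zv j))⁻¹ := by
  have hn'L : n' ≤ L := by omega
  have hkmem : k ∈ tailSites L n' := mem_tailSites.2 hk
  have hlast : univ.filter (fun j => j < lastSite hL) = univ.erase (lastSite hL) := by
    ext j; simp only [mem_filter, mem_univ, true_and, mem_erase, ne_eq, and_true, Fin.lt_def, lastSite_val, Fin.ext_iff]; omega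
  have hempty : univ.filter (fun j => lastSite hL < j) = ∅ := by
    ext j; simp only [mem_filter, mem_univ, true_and, Fin.lt_def, lastSite_val, notMem_empty, iff_false]; omega
  have hA : ∏ i : Fin n', aPair q (zFirst hL i) (zv k) = (∏ i : Fin n', qbr (genC ℂ q * zv k / zFirst hL i)) *
      (∏ i : Fin n', qbr (zFirst hL i / zv k)) * (∏ i : Fin n', qbr (genC ℂ q * zFirst hL i * zv k)) *
      ∏ i : Fin n', qbr (genC ℂ q ^ 2 * zFirst hL i * zv k) := by
    simp only [aPair, prod_mul_distrib]
  have hE : eT q zv (lastSite hL) (zv k) = ∏ j ∈ univ.erase (lastSite hL), qbr (genC ℂ q * zv j / zv k) := by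
    unfold eT; rw [hempty, prod_empty, one_mul, hlast]
  have hG : gFac q (zv (L := L)) (zv k) = ((∏ j ∈ univ.erase (lastSite hL), qbr (genC ℂ q * zv j / zv k)) *
      qbr (genC ℂ q * zv (lastSite hL) / zv k) *
      ((∏ i : Fin n', qbr (genC ℂ q ^ 2 * zFirst hL i * zv k)) * (qbr (genC ℂ q ^ 2 * zv k * zv k) *
        ∏ j ∈ (tailSites L n').erase k, qbr (genC ℂ q ^ 2 * zv k * zv j))))⁻¹ := by
    unfold gFac
    rw [← mul_prod_erase univ (fun j => qbr (genC ℂ q * zv j / zv k)) (mem_univ (lastSite hL)), mul_comm (qbr _) (∏ j ∈ _, _),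
      prod_univ_split_tail hn'L (fun j => qbr (genC ℂ q ^ 2 * zv k * zv j)),
      ← mul_prod_erase _ (fun j => qbr (genC ℂ q ^ 2 * zv k * zv j)) hkmem]
    have : ∏ i : Fin n', qbr (genC ℂ q ^ 2 * zv k * zv (Fin.castLE hn'L i)) = ∏ i : Fin n', qbr (genC ℂ q ^ 2 * zFirst hL i * zv k) :=
      prod_congr rfl fun i _ => by rw [show zFirst hL i = zv (Fin.castLE hn'L i) from rfl]; ring_nf
    rw [this]
  have hR : resWeight L k = -((∏ i : Fin n', qbr (zFirst hL i / zv k)) * ∏ j ∈ (tailSites L n').erase k, qbr (zv j / zv k))⁻¹ := by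
    unfold resWeight; rw [prod_erase_split_tail hn'L hk]; rfl
  rw [gTail, hA, hE, hG, hR]
  simp only [prod_mul_distrib]
  refine gTail_identity ?_ ?_ (qbr_genC_sq_zv_mul_ne_zero hq k k) (zv_ne_zero k) ?_ (qbr_genC_zv_div_ne_zero hq _ _) ?_ ?_
  · exact prod_ne_zero_iff.2 fun i _ => qbr_zv_div_ne_zero (fun h => by
      have := congrArg Fin.val h; simp at this; omega)
  · exact prod_ne_zero_iff.2 fun i _ => qbr_genC_sq_zv_mul_ne_zero hq _ _
  · exact prod_ne_zero_iff.2 fun j _ => qbr_genC_zv_div_ne_zero hq _ _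
  · exact prod_ne_zero_iff.2 fun j _ => qbr_genC_sq_zv_mul_ne_zero hq _ _
  · exact prod_ne_zero_iff.2 fun j hj => qbr_zv_div_ne_zero (ne_of_mem_erase hj)

end Tail

/-! ### The nodes `t_k` and the Lagrange weights -/

section Nodes

variable (q : ℂ) (hL : n' + 1 ≤ L)

/-- **The nodes**: `t_k = t(z_k)` for the sites `k` and `t_* = t(z_L⁻¹)` for the extra node `L`.
[cite: HagendorfLienardy2021, Prop. 3.7 (Case 2)] -/
def tNode (j : Fin (L + 1)) : RapidityField ℂ :=
  Fin.lastCases (tOf q (zv (lastSite hL))⁻¹) (fun k => tOf q (zv k)) j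

/-- The node of a site. [folklore] -/
@[simp] theorem tNode_castSucc (k : Fin L) : tNode q hL k.castSucc = tOf q (zv k) := by simp [tNode]
/-- The extra node. [folklore] -/
@[simp] theorem tNode_last : tNode q hL (Fin.last L) = tOf q (zv (lastSite hL))⁻¹ := by simp [tNode]

/-- The node set: the tail sites and the extra node. [folklore] -/
def nodeSet (L n' : ℕ) : Finset (Fin (L + 1)) := univ.filter fun j : Fin (L + 1) => n' ≤ j.val

/-- Membership in the node set. [folklore] -/
@[simp] theorem mem_nodeSet {j : Fin (L + 1)} : j ∈ nodeSet L n' ↔ n' ≤ j.val := by simp [nodeSet]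

/-- The node set is the image of the tail plus the extra node. [folklore] -/
theorem nodeSet_eq (hL : n' + 1 ≤ L) : nodeSet L n' = insert (Fin.last L) ((tailSites L n').map Fin.castSuccEmb) := by
  ext j
  simp only [mem_nodeSet, mem_insert, mem_map, mem_tailSites, Fin.castSuccEmb_apply]
  constructor
  · intro hj
    rcases Fin.eq_castSucc_or_eq_last j with ⟨k, rfl⟩ | rfl
    · exact Or.inr ⟨k, by simpa using hj, rfl⟩
    · exact Or.inl rfl
  · rintro (rfl | ⟨k, hk, rfl⟩)
    · simp; omega
    · simpa using hk

/-- The extra node is not a tail node. [folklore] -/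
theorem last_notMem_map_tailSites : Fin.last L ∉ (tailSites L n').map Fin.castSuccEmb := by
  simp only [mem_map, Fin.castSuccEmb_apply, not_exists, not_and]
  exact fun k _ => Fin.castSucc_ne_last k

/-- **Sums over the nodes.** [folklore] -/
theorem sum_nodeSet (hL : n' + 1 ≤ L) {M : Type*} [AddCommMonoid M] (g : Fin (L + 1) → M) :
    ∑ j ∈ nodeSet L n', g j = (∑ k ∈ tailSites L n', g k.castSucc) + g (Fin.last L) := by
  rw [nodeSet_eq hL, sum_insert last_notMem_map_tailSites, sum_map, add_comm]; rfl

/-- **Products over the nodes other than a tail node.** [folklore] -/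
theorem prod_nodeSet_erase_castSucc (hL : n' + 1 ≤ L) {M : Type*} [CommMonoid M] (k : Fin L) (g : Fin (L + 1) → M) :
    ∏ j ∈ (nodeSet L n').erase k.castSucc, g j = (∏ j ∈ (tailSites L n').erase k, g j.castSucc) * g (Fin.last L) := by
  rw [nodeSet_eq hL, erase_insert_of_ne (Fin.castSucc_ne_last k).symm,
    prod_insert (fun h => last_notMem_map_tailSites (mem_of_mem_erase h)), mul_comm]
  congr 1
  change ∏ x ∈ ((tailSites L n').map Fin.castSuccEmb).erase (Fin.castSuccEmb k), g x = _
  rw [← map_erase, prod_map]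
  rfl

/-- The number of nodes. [folklore] -/
theorem card_nodeSet (hL : n' + 1 ≤ L) : (nodeSet L n').card = L - n' + 1 := by
  rw [nodeSet_eq hL, card_insert_of_notMem last_notMem_map_tailSites, card_map, card_tailSites (by omega)]

/-- `P(t) = ∏_{i<n'} (t - τ(z_i))` evaluated. [folklore] -/
def pVal (x : RapidityField ℂ) : RapidityField ℂ := ∏ i : Fin n', (x - tauOf q (zFirst hL i))

/-- **The Lagrange weight** `ρ̂_j = P(t_j)/∏_{j' ≠ j} (t_j - t_{j'})`. [folklore] -/
def rhoHat (j : Fin (L + 1)) : RapidityField ℂ :=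
  pVal q hL (tNode q hL j) / ∏ j' ∈ (nodeSet L n').erase j, (tNode q hL j - tNode q hL j')

variable {q} (hq : q ^ 2 + q + 1 = 0)
include hq

/-- **The nodes are distinct** (`t(x) - t(y) = -c⁻²[y/x][c² x y]`). [folklore] -/
theorem tNode_injOn : Set.InjOn (tNode q hL) (nodeSet L n') := by
  have hc : genC ℂ q ≠ 0 := genC_ne_zero'' (ne_zero_of_quad hq)
  have key : ∀ x y : RapidityField ℂ, x ≠ 0 → y ≠ 0 → qbr (y / x) ≠ 0 → qbr (genC ℂ q ^ 2 * x * y) ≠ 0 → tOf q x ≠ tOf q y := by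
    intro x y hx hy h1 h2 heq
    have := qbr_mul_qbr_eq_tOf_sub hq hx hy
    rw [heq, sub_self, mul_zero] at this
    exact mul_ne_zero h1 h2 this
  intro j hj j' hj' hjj
  rcases Fin.eq_castSucc_or_eq_last j with ⟨k, rfl⟩ | rfl <;> rcases Fin.eq_castSucc_or_eq_last j' with ⟨k', rfl⟩ | rfl
  · simp only [tNode_castSucc] at hjj
    by_contra hne
    have hkk : k ≠ k' := fun h => hne (by rw [h])
    exact key _ _ (zv_ne_zero k) (zv_ne_zero k') (qbr_zv_div_ne_zero hkk.symm) (qbr_genC_sq_zv_mul_ne_zero hq k k') hjj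
  · simp only [tNode_castSucc, tNode_last] at hjj
    exfalso
    refine key _ _ (zv_ne_zero k) (inv_ne_zero (zv_ne_zero _)) ?_ ?_ hjj
    · rw [div_eq_mul_inv, ← mul_inv, qbr_inv, neg_ne_zero]; exact qbr_zv_mul_ne_zero _ _
    · rw [← div_eq_mul_inv]; exact qbr_genC_sq_zv_div_ne_zero hq _ _
  · simp only [tNode_castSucc, tNode_last] at hjj
    exfalso
    refine key _ _ (zv_ne_zero k') (inv_ne_zero (zv_ne_zero _)) ?_ ?_ hjj.symm
    · rw [div_eq_mul_inv, ← mul_inv, qbr_inv, neg_ne_zero]; exact qbr_zv_mul_ne_zero _ _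
    · rw [← div_eq_mul_inv]; exact qbr_genC_sq_zv_div_ne_zero hq _ _
  · rfl

/-- **Lagrange: `Σ_j ρ̂_j = 0`** since `deg P = n' ≤ #nodes - 2`. [cite: HagendorfLienardy2021, Prop. 3.7 (Case 2), (3.35)] -/
theorem sum_rhoHat_eq_zero (h2 : 2 * n' + 1 ≤ L) : ∑ j ∈ nodeSet L n', rhoHat q hL j = 0 := by
  have hP : ∀ x, pVal q hL x = (Lagrange.nodal univ (fun i : Fin n' => tauOf q (zFirst hL i))).eval x := fun x => by
    rw [Lagrange.eval_nodal]; rfl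
  unfold rhoHat
  simp_rw [hP]
  refine sum_eval_div_prod_sub_eq_zero (tNode_injOn hL hq) ?_
  rw [Lagrange.natDegree_nodal, card_univ, Fintype.card_fin, card_nodeSet hL]
  omega

end Nodes

/-! ### The inversion of the last rapidity on the nodes -/

section InvNodes

variable {q : ℂ} (hq : q ^ 2 + q + 1 = 0) (hL : n' + 1 ≤ L)

/-- The node permutation induced by `z_L ↦ 1/z_L`: exchange of the last site node and the extra node. [folklore] -/
def nodeSwap : Equiv.Perm (Fin (L + 1)) := Equiv.swap (lastSite hL).castSucc (Fin.last L)

/-- `genInv L` commutes with `t`. [folklore] -/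
theorem genInv_tOf (x : RapidityField ℂ) : genInv ℂ L (tOf q x) = tOf q (genInv ℂ L x) := by
  simp only [tOf, map_add, map_mul, map_pow, map_inv₀, genInv_genC]

/-- `genInv L` fixes the `τ(z_i)`. [folklore] -/
theorem genInv_tauOf_zFirst (i : Fin n') : genInv ℂ L (tauOf q (zFirst hL i)) = tauOf q (zFirst hL i) := by
  simp only [tauOf, map_add, map_mul, map_pow, map_inv₀, genInv_genC, genInv_zFirst hL i]

/-- **`genInv L` permutes the nodes.** [folklore] -/
theorem genInv_tNode (j : Fin (L + 1)) : genInv ℂ L (tNode q hL j) = tNode q hL (nodeSwap hL j) := by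
  have huL : (lastSite hL).val + 1 = L := by simp; omega
  rcases Fin.eq_castSucc_or_eq_last j with ⟨k, rfl⟩ | rfl
  · by_cases hk : k = lastSite hL
    · subst hk
      rw [nodeSwap, Equiv.swap_apply_left, tNode_castSucc, tNode_last, genInv_tOf, genInv_zv_last huL]
    · rw [nodeSwap, Equiv.swap_apply_of_ne_of_ne (fun h => hk (Fin.castSucc_injective _ h)) (Fin.castSucc_ne_last k),
        tNode_castSucc, genInv_tOf, genInv_zv_of_ne]
      intro h; apply hk; exact Fin.ext (by simp; omega)
  · rw [nodeSwap, Equiv.swap_apply_right, tNode_last, tNode_castSucc, genInv_tOf, map_inv₀, genInv_zv_last huL, inv_inv]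

/-- The node permutation preserves the node set. [folklore] -/
theorem nodeSwap_mem {j : Fin (L + 1)} : nodeSwap hL j ∈ nodeSet L n' ↔ j ∈ nodeSet L n' := by
  simp only [mem_nodeSet, nodeSwap, Equiv.swap_apply_def]
  split_ifs with h1 h2
  · subst h1; simp; omega
  · subst h2; simp; omega
  · rfl

/-- `genInv L` fixes `P`. [folklore] -/
theorem genInv_pVal (x : RapidityField ℂ) : genInv ℂ L (pVal q hL x) = pVal q hL (genInv ℂ L x) := by
  unfold pVal; rw [map_prod]
  exact prod_congr rfl fun i _ => by rw [map_sub, genInv_tauOf_zFirst]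

include hq

/-- **`genInv L` permutes the Lagrange weights.** [folklore] -/
theorem genInv_rhoHat (j : Fin (L + 1)) : genInv ℂ L (rhoHat q hL j) = rhoHat q hL (nodeSwap hL j) := by
  have _ := hq
  unfold rhoHat
  rw [map_div₀, genInv_pVal, genInv_tNode, map_prod]
  congr 1
  -- reindex the product by the node permutation
  refine prod_nbij (nodeSwap hL) (fun j' hj' => ?_) (fun a _ b _ h => (nodeSwap hL).injective h) (fun j'' hj'' => ?_) (fun j' _ => ?_)
  · exact mem_erase.2 ⟨fun h => ne_of_mem_erase hj' ((nodeSwap hL).injective h), (nodeSwap_mem hL).2 (mem_of_mem_erase hj')⟩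
  · refine ⟨(nodeSwap hL).symm j'', mem_erase.2 ⟨fun h => ?_, ?_⟩, Equiv.apply_symm_apply _ _⟩
    · exact ne_of_mem_erase (mem_coe.1 hj'') (by rw [← h, Equiv.apply_symm_apply])
    · have := (nodeSwap_mem hL (j := (nodeSwap hL).symm j'')).1 (by rw [Equiv.apply_symm_apply]; exact mem_of_mem_erase (mem_coe.1 hj''))
      exact this
  · rw [map_sub, genInv_tNode, genInv_tNode]

end InvNodes

/-! ### The tail factor through the Lagrange weights, and the three scalar identities -/

section Scalar

variable (q : ℂ) (hL : n' + 1 ≤ L)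

/-- `X_k = (t_k - t_*)/(z_k [c z_L/z_k])`, the `k`-dependent scalar left after extracting the weight. [folklore] -/
def xFac (k : Fin L) : RapidityField ℂ :=
  (tOf q (zv k) - tOf q (zv (lastSite hL))⁻¹) / (zv k * qbr (genC ℂ q * zv (lastSite hL) / zv k))

/-- The same after inverting `z_L`. [folklore] -/
def xFacInv (k : Fin L) : RapidityField ℂ :=
  (tOf q (zv k) - tOf q (zv (lastSite hL))) / (zv k * qbr (genC ℂ q * (zv (lastSite hL))⁻¹ / zv k))

/-- The constant `A = -(c²)^{n'} ((-c²)^{L-n'-1})⁻¹`. [folklore] -/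
def aCoef (L n' : ℕ) : RapidityField ℂ := -(genC ℂ q ^ 2) ^ n' * ((-genC ℂ q ^ 2) ^ (L - n' - 1))⁻¹

variable {q} (hq : q ^ 2 + q + 1 = 0)

omit hL in
/-- `(t(x) - t(u⁻¹))/(x [c u/x]) = -c (u² x² - 1)/(u x²)`. [folklore] -/
theorem xFac_formula {x u : RapidityField ℂ} (hx : x ≠ 0) (hu : u ≠ 0) (hc : genC ℂ q ≠ 0) (hxu : x ^ 2 ≠ genC ℂ q ^ 2 * u ^ 2) :
    (tOf q x - tOf q u⁻¹) / (x * qbr (genC ℂ q * u / x)) = -genC ℂ q * (u ^ 2 * x ^ 2 - 1) / (u * x ^ 2) := by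
  have h1 : x ^ 2 - genC ℂ q ^ 2 * u ^ 2 ≠ 0 := sub_ne_zero.2 hxu
  have hden : x * qbr (genC ℂ q * u / x) = -(x ^ 2 - genC ℂ q ^ 2 * u ^ 2) / (genC ℂ q * u) := by
    unfold qbr; field_simp; ring
  have hnum : tOf q x - tOf q u⁻¹ = (x ^ 2 - genC ℂ q ^ 2 * u ^ 2) * (u ^ 2 * x ^ 2 - 1) / (u ^ 2 * x ^ 2) := by
    unfold tOf; field_simp; ring
  rw [hden, hnum]
  field_simp

include hq

/-- **The tail factor through the Lagrange weight**: `G_k = A ρ̂_k X_k`. [cite: HagendorfLienardy2021, Prop. 3.7 (Case 2)] -/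
theorem gTail_eq_rhoHat {k : Fin L} (hk : n' ≤ k.val) :
    gTail q hL k = aCoef q L n' * rhoHat q hL k.castSucc * xFac q hL k := by
  have hc : genC ℂ q ≠ 0 := genC_ne_zero'' (ne_zero_of_quad hq)
  rw [gTail_eq hq hL hk]
  -- numerator through `P(t_k)`, tail product through the `t_j`
  have hU : ∏ i : Fin n', qbr (genC ℂ q * zv k / zFirst hL i) * qbr (genC ℂ q * zFirst hL i * zv k) =
      (genC ℂ q ^ 2) ^ n' * pVal q hL (tOf q (zv k)) := by
    unfold pVal
    rw [show (genC ℂ q ^ 2) ^ n' = ∏ _i : Fin n', genC ℂ q ^ 2 by rw [prod_const, card_univ, Fintype.card_fin], ← prod_mul_distrib]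
    exact prod_congr rfl fun i _ => qbr_mul_qbr_eq_tOf_sub_tauOf hq (zv_ne_zero _) (zv_ne_zero _)
  have hT : ∏ j ∈ (tailSites L n').erase k, qbr (zv j / zv k) * qbr (genC ℂ q ^ 2 * zv k * zv j) =
      (-genC ℂ q ^ 2) ^ (L - n' - 1) * ∏ j ∈ (tailSites L n').erase k, (tOf q (zv k) - tOf q (zv j)) := by
    have hcard : ((tailSites L n').erase k).card = L - n' - 1 := by
      rw [card_erase_of_mem (mem_tailSites.2 hk), card_tailSites (by omega)]
    rw [← hcard, ← prod_const, ← prod_mul_distrib]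
    exact prod_congr rfl fun j _ => qbr_mul_qbr_eq_tOf_sub hq (zv_ne_zero _) (zv_ne_zero _)
  have hρ : rhoHat q hL k.castSucc = pVal q hL (tOf q (zv k)) /
      ((∏ j ∈ (tailSites L n').erase k, (tOf q (zv k) - tOf q (zv j))) * (tOf q (zv k) - tOf q (zv (lastSite hL))⁻¹)) := by
    unfold rhoHat
    rw [prod_nodeSet_erase_castSucc hL k]
    simp only [tNode_castSucc, tNode_last]
  -- nonvanishing
  have hprod : ∏ j ∈ (tailSites L n').erase k, (tOf q (zv k) - tOf q (zv j)) ≠ 0 := by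
    refine prod_ne_zero_iff.2 fun j hj => sub_ne_zero.2 fun h => ?_
    have := tNode_injOn hL hq ((mem_nodeSet (j := k.castSucc)).2 (by simpa using hk))
      ((mem_nodeSet (j := j.castSucc)).2 (by simpa using (mem_tailSites.1 (mem_of_mem_erase hj)))) (by simpa using h)
    exact ne_of_mem_erase hj (Fin.castSucc_injective _ this).symm
  have hstar : tOf q (zv k) - tOf q (zv (lastSite hL))⁻¹ ≠ 0 := by
    refine sub_ne_zero.2 fun h => ?_
    have := tNode_injOn hL hq ((mem_nodeSet (j := k.castSucc)).2 (by simpa using hk))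
      ((mem_nodeSet (j := Fin.last L)).2 (by simp; omega)) (by simpa using h)
    exact Fin.castSucc_ne_last k this
  have hcu : qbr (genC ℂ q * zv (lastSite hL) / zv k) ≠ 0 := qbr_genC_zv_div_ne_zero hq _ _
  have hpow : (-genC ℂ q ^ 2) ^ (L - n' - 1) ≠ 0 := pow_ne_zero _ (neg_ne_zero.2 (pow_ne_zero _ hc))
  have hz0 : zv k ≠ 0 := zv_ne_zero k
  rw [hU, hT, hρ]
  unfold aCoef xFac
  generalize pVal q hL (tOf q (zv k)) = P
  generalize ∏ j ∈ (tailSites L n').erase k, (tOf q (zv k) - tOf q (zv j)) = T at hprod ⊢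
  generalize tOf q (zv k) - tOf q (zv (lastSite hL))⁻¹ = D at hstar ⊢
  field_simp

/-- **First scalar identity** (tail sites other than the last): `z_L² X_k - ι_L X_k = -c z_L [z_L²]`. [folklore] -/
theorem scalar_I1 (k : Fin L) :
    zv (lastSite hL) ^ 2 * xFac q hL k - xFacInv q hL k = -genC ℂ q * zv (lastSite hL) * qbr (zv (lastSite hL) * zv (lastSite hL)) := by
  have hc : genC ℂ q ≠ 0 := genC_ne_zero'' (ne_zero_of_quad hq)
  set u := zv (lastSite hL) with hu
  set x := zv k with hx
  have hu0 : u ≠ 0 := zv_ne_zero _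
  have hx0 : x ≠ 0 := zv_ne_zero _
  have h1 : xFac q hL k = -genC ℂ q * (u ^ 2 * x ^ 2 - 1) / (u * x ^ 2) :=
    xFac_formula hx0 hu0 hc (zv_sq_ne_genC_sq_mul_sq hq _ _)
  have h2 : xFacInv q hL k = -genC ℂ q * (u⁻¹ ^ 2 * x ^ 2 - 1) / (u⁻¹ * x ^ 2) := by
    have hxu : x ^ 2 ≠ genC ℂ q ^ 2 * u⁻¹ ^ 2 := by
      intro h
      have h4 := genC_pow_mul_zv_mul_sq_ne_one (L := L) (q_pow_four_ne_one hq) k (lastSite hL)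
      apply h4
      rw [← hx, ← hu, mul_pow, mul_pow, h]
      field_simp
      linear_combination (genC ℂ q ^ 3 + 1) * genC_pow_three hq
    have := xFac_formula (q := q) hx0 (inv_ne_zero hu0) hc hxu
    rw [inv_inv] at this
    exact this
  rw [h1, h2]
  unfold qbr
  field_simp
  ring

omit hL in
/-- `t(u) - t(u⁻¹) = (1 - c²) [u²]`. [folklore] -/
theorem tOf_sub_tOf_inv {u : RapidityField ℂ} (hu : u ≠ 0) : tOf q u - tOf q u⁻¹ = (1 - genC ℂ q ^ 2) * qbr (u * u) := by
  have _ := hq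
  unfold tOf qbr; field_simp; ring

omit hL in
/-- `1 - c² = -c [c]`. [folklore] -/
theorem one_sub_genC_sq : (1 - genC ℂ q ^ 2) = -genC ℂ q * qbr (genC ℂ q) := by
  have hc : genC ℂ q ≠ 0 := genC_ne_zero'' (ne_zero_of_quad hq)
  unfold qbr; field_simp; ring

/-- **Second scalar identity** (the last site): `z_L² X_L = -c z_L [z_L²]`. [folklore] -/
theorem scalar_I2 : zv (lastSite hL) ^ 2 * xFac q hL (lastSite hL) = -genC ℂ q * zv (lastSite hL) * qbr (zv (lastSite hL) * zv (lastSite hL)) := by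
  have hu0 : zv (lastSite hL) ≠ 0 := zv_ne_zero _
  have hqc : qbr (genC ℂ q) ≠ 0 := qbr_genC_ne_zero hq
  unfold xFac
  rw [mul_div_assoc (genC ℂ q) (zv (lastSite hL)), div_self hu0, mul_one, tOf_sub_tOf_inv hq hu0, one_sub_genC_sq hq]
  field_simp

/-- **Third scalar identity** (the last site, inverted): `ι_L X_L = c z_L [z_L²]`. [folklore] -/
theorem scalar_I3 : genInv ℂ L (xFac q hL (lastSite hL)) = genC ℂ q * zv (lastSite hL) * qbr (zv (lastSite hL) * zv (lastSite hL)) := by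
  have hu0 : zv (lastSite hL) ≠ 0 := zv_ne_zero _
  have hqc : qbr (genC ℂ q) ≠ 0 := qbr_genC_ne_zero hq
  have huL : (lastSite hL).val + 1 = L := by simp; omega
  unfold xFac
  rw [mul_div_assoc (genC ℂ q) (zv (lastSite hL)), div_self hu0, mul_one, map_div₀, map_sub, genInv_tOf, genInv_tOf, map_inv₀,
    map_mul, map_qbr, genInv_genC, genInv_zv_last huL, inv_inv,
    show tOf q (zv (lastSite hL))⁻¹ - tOf q (zv (lastSite hL)) = -(tOf q (zv (lastSite hL)) - tOf q (zv (lastSite hL))⁻¹) by ring,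
    tOf_sub_tOf_inv hq hu0, one_sub_genC_sq hq]
  field_simp

omit hq in
/-- `ι_L X_k = X_k^{inv}` for the other tail sites. [folklore] -/
theorem genInv_xFac {k : Fin L} (hk : k ≠ lastSite hL) : genInv ℂ L (xFac q hL k) = xFacInv q hL k := by
  have huL : (lastSite hL).val + 1 = L := by simp; omega
  have hkfix : genInv ℂ L (zv k) = zv k := genInv_zv_of_ne fun h => hk (Fin.ext (by simp; omega))
  unfold xFac xFacInv
  rw [map_div₀, map_sub, genInv_tOf, genInv_tOf, map_inv₀, map_mul, map_qbr, map_div₀, map_mul, genInv_genC,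
    genInv_zv_last huL, inv_inv, hkfix]

omit hq hL in
/-- `ι_L` fixes the constant `A`. [folklore] -/
theorem genInv_aCoef : genInv ℂ L (aCoef q L n') = aCoef q L n' := by
  simp only [aCoef, map_mul, map_neg, map_pow, map_inv₀, genInv_genC]

/-- **The difference `z_L² G_k - ι_L G_k` through the Lagrange weights.** [cite: HagendorfLienardy2021, Prop. 3.7 (Case 2)] -/
theorem diff_gTail_of_ne {k : Fin L} (hk : n' ≤ k.val) (hkl : k ≠ lastSite hL) :
    zv (lastSite hL) ^ 2 * gTail q hL k - genInv ℂ L (gTail q hL k) =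
      aCoef q L n' * (-genC ℂ q * zv (lastSite hL) * qbr (zv (lastSite hL) * zv (lastSite hL))) * rhoHat q hL k.castSucc := by
  rw [gTail_eq_rhoHat hL hq hk, map_mul, map_mul, genInv_aCoef, genInv_rhoHat hq hL,
    genInv_xFac hL hkl, nodeSwap, Equiv.swap_apply_of_ne_of_ne (fun h => hkl (Fin.castSucc_injective _ h)) (Fin.castSucc_ne_last k)]
  have := scalar_I1 hL hq k
  linear_combination aCoef q L n' * rhoHat q hL k.castSucc * this

/-- The same at the last site: both nodes `t_L` and `t_*` appear. [cite: HagendorfLienardy2021, Prop. 3.7 (Case 2)] -/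
theorem diff_gTail_last (hlast : n' ≤ (lastSite hL).val) :
    zv (lastSite hL) ^ 2 * gTail q hL (lastSite hL) - genInv ℂ L (gTail q hL (lastSite hL)) =
      aCoef q L n' * (-genC ℂ q * zv (lastSite hL) * qbr (zv (lastSite hL) * zv (lastSite hL))) *
        (rhoHat q hL (lastSite hL).castSucc + rhoHat q hL (Fin.last L)) := by
  rw [gTail_eq_rhoHat hL hq hlast, map_mul, map_mul, genInv_aCoef, genInv_rhoHat hq hL,
    scalar_I3 hL hq, nodeSwap, Equiv.swap_apply_left]
  have := scalar_I2 hL hq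
  linear_combination aCoef q L n' * rhoHat q hL (lastSite hL).castSucc * this

/-- **The differences sum to zero**: `Σ_{k ≥ n'} (z_L² G_k - ι_L G_k) = -A c z_L [z_L²] Σ_j ρ̂_j = 0`.
[cite: HagendorfLienardy2021, Prop. 3.7 (Case 2), (3.35)] -/
theorem sum_diff_gTail_eq_zero (h2 : 2 * n' + 1 ≤ L) :
    ∑ k ∈ tailSites L n', (zv (lastSite hL) ^ 2 * gTail q hL k - genInv ℂ L (gTail q hL k)) = 0 := by
  have hlast : n' ≤ (lastSite hL).val := by simp; omega
  have hmem : lastSite hL ∈ tailSites L n' := mem_tailSites.2 hlast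
  rw [← add_sum_erase _ _ hmem, diff_gTail_last hL hq hlast,
    sum_congr rfl fun k hk => diff_gTail_of_ne hL hq (mem_tailSites.1 (mem_of_mem_erase hk)) (ne_of_mem_erase hk), ← mul_sum]
  have hsum := sum_rhoHat_eq_zero hL hq h2
  rw [sum_nodeSet hL, ← add_sum_erase _ _ hmem] at hsum
  linear_combination aCoef q L n' * (-genC ℂ q * zv (lastSite hL) * qbr (zv (lastSite hL) * zv (lastSite hL))) * hsum

/-- **Right reflection of the base component**: `ι_L Ψ_{a*} = z_L² Ψ_{a*}` (HL (3.35) ⇒ (3.26) for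
`(1, …, n-1, N)` at `s = 1`, `β̄ → ∞`). [cite: HagendorfLienardy2021, Prop. 3.7 (Case 2), (3.35)] -/
theorem genInv_vPsi_aStar (h2 : 2 * n' + 1 ≤ L) :
    genInv ℂ L (vPsi q L (n' + 1) (aStar hL)) = zv (lastSite hL) ^ 2 * vPsi q L (n' + 1) (aStar hL) := by
  rw [vPsi_aStar_eq_sum q hL, map_mul, genInv_cFac hq hL, map_sum, mul_left_comm, ← sub_eq_zero, ← mul_sub, mul_sum, ← sum_sub_distrib]
  refine mul_eq_zero_of_right _ ?_
  have := sum_diff_gTail_eq_zero hL hq h2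
  rw [← neg_eq_zero, ← this, ← sum_neg_distrib]
  exact sum_congr rfl fun k _ => by ring

end Scalar

/-! ### The right reflection relation for the components with the last site down -/

section RightDown

variable {q : ℂ} (hq : q ^ 2 + q + 1 = 0) {L' : ℕ}

/-- Appending a down spin at a new last site adds one down spin. [folklore] -/
theorem downCount_snoc_true (σ' : SpinConfig L') : downCount (Fin.snoc σ' true : SpinConfig (L' + 1)) = downCount σ' + 1 := by
  unfold downCount
  rw [card_filter, card_filter, Fin.sum_univ_castSucc]
  simp [Fin.snoc_castSucc, Fin.snoc_last]

/-- A move below the last site commutes with appending the last spin. [folklore] -/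
theorem spinFlip_snoc {s t : Fin L'} (hst : s ≠ t) (σ' : SpinConfig L') (b : Bool) :
    spinFlip s.castSucc t.castSucc (Fin.snoc σ' b : SpinConfig (L' + 1)) = Fin.snoc (spinFlip s t σ') b := by
  have hst' : s.castSucc ≠ t.castSucc := fun h => hst (Fin.castSucc_injective _ h)
  funext j
  rcases Fin.eq_castSucc_or_eq_last j with ⟨k, rfl⟩ | rfl
  · rw [Fin.snoc_castSucc]
    by_cases hks : k = s
    · subst hks; rw [spinFlip_apply_left hst', spinFlip_apply_left hst, Fin.snoc_castSucc]
    · by_cases hkt : k = t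
      · subst hkt; rw [spinFlip_apply_right, spinFlip_apply_right, Fin.snoc_castSucc]
      · rw [spinFlip_apply_of_ne (fun h => hks (Fin.castSucc_injective _ h)) (fun h => hkt (Fin.castSucc_injective _ h)),
          spinFlip_apply_of_ne hks hkt, Fin.snoc_castSucc]
  · rw [spinFlip_apply_of_ne (Fin.castSucc_ne_last s).symm (Fin.castSucc_ne_last t).symm, Fin.snoc_last, Fin.snoc_last]

/-- A configuration with the last site down is an appended one. [folklore] -/
theorem snoc_init_of_last {σ : SpinConfig (L' + 1)} (h : σ (Fin.last L') = true) :
    (Fin.snoc (fun j : Fin L' => σ j.castSucc) true : SpinConfig (L' + 1)) = σ := by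
  funext j
  rcases Fin.eq_castSucc_or_eq_last j with ⟨k, rfl⟩ | rfl
  · rw [Fin.snoc_castSucc]
  · rw [Fin.snoc_last, h]

/-- The last site of `L' + 1` sites. [folklore] -/
theorem lastSite_eq_last (hL : n' + 1 ≤ L' + 1) : lastSite hL = Fin.last L' := Fin.ext (by simp)

/-- `a*` is strictly increasing. [folklore] -/
theorem strictMono_aStar (hL : n' + 1 ≤ L' + 1) : StrictMono (aStar hL) := by
  intro a b hab
  rcases Fin.eq_castSucc_or_eq_last a with ⟨a', rfl⟩ | rfl <;> rcases Fin.eq_castSucc_or_eq_last b with ⟨b', rfl⟩ | rfl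
  · rw [aStar_castSucc, aStar_castSucc]
    exact Fin.strictMono_castLE _ (Fin.castSucc_lt_castSucc_iff.1 hab)
  · rw [aStar_castSucc, aStar_last, Fin.lt_def]
    simp; omega
  · exact absurd hab (not_lt.2 (le_of_lt (Fin.castSucc_lt_last b')))
  · exact absurd hab (lt_irrefl _)

/-- **The enumeration of the base configuration** `σ* = (packed, ↓)` is `a*`. [folklore] -/
theorem downEnum_snoc_packed (hL : n' + 1 ≤ L' + 1) (h : downCount (Fin.snoc (packed L' n') true : SpinConfig (L' + 1)) = n' + 1) :
    downEnum (Fin.snoc (packed L' n') true : SpinConfig (L' + 1)) h = aStar hL := by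
  symm
  refine eq_downEnum h (fun ℓ => ?_) (strictMono_aStar hL)
  rcases Fin.eq_castSucc_or_eq_last ℓ with ⟨ℓ', rfl⟩ | rfl
  · rw [aStar_castSucc, show siteOf hL ℓ' = (Fin.castLE (by omega : n' ≤ L') ℓ').castSucc from Fin.ext rfl, Fin.snoc_castSucc]
    simp [packed]
  · rw [aStar_last, lastSite_eq_last, Fin.snoc_last]

/-- `genSwap (s+1)` fixes the rapidity of the last site when the move is below it. [folklore] -/
theorem genSwap_zv_last {s : Fin L'} (hs : s.val + 1 < L') : genSwap ℂ (s.val + 1) (zv (Fin.last L')) = zv (Fin.last L') := by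
  unfold zv
  rw [genSwap_genZ, zswap_of_ne _ (by simp; omega) (by simp; omega)]

include hq

/-- **Right reflection, last site down** (HL (3.26) at `s = 1`, `β̄ → ∞`): `ι_L Ψ_σ = z_L² Ψ_σ` for every
configuration of the sector whose last spin is down (`2 n' ≤ L'` sites before the last one, `n'+1`
down spins). [cite: HagendorfLienardy2021, Prop. 3.7 (Case 2)] -/
theorem genInv_vPsiVec_of_last_down (h2 : 2 * n' ≤ L') :
    ∀ σ : SpinConfig (L' + 1), downCount σ = n' + 1 → σ (Fin.last L') = true →
      genInv ℂ (L' + 1) (vPsiVec q (L' + 1) (n' + 1) σ) = zv (Fin.last L') ^ 2 * vPsiVec q (L' + 1) (n' + 1) σ := by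
  have hL : n' + 1 ≤ L' + 1 := by omega
  -- reduce to appended configurations and induct on the first `L'` sites
  suffices H : ∀ σ' : SpinConfig L', downCount σ' = n' →
      genInv ℂ (L' + 1) (vPsiVec q (L' + 1) (n' + 1) (Fin.snoc σ' true)) =
        zv (Fin.last L') ^ 2 * vPsiVec q (L' + 1) (n' + 1) (Fin.snoc σ' true) by
    intro σ hσ hlast
    rw [← snoc_init_of_last hlast] at hσ ⊢
    rw [downCount_snoc_true] at hσ
    exact H _ (by omega)
  refine sector_induction ?_ ?_
  · have h : downCount (Fin.snoc (packed L' n') true : SpinConfig (L' + 1)) = n' + 1 := by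
      rw [downCount_snoc_true, downCount_packed (by omega)]
    rw [vPsiVec_of_eq q h, downEnum_snoc_packed hL h, ← lastSite_eq_last hL]
    exact genInv_vPsi_aStar hL hq (by omega)
  · intro σ' s t hst hσ' hs ht ih
    have hne : s ≠ t := fun h' => by rw [h'] at hst; omega
    have htL : t.val < L' := t.isLt
    have hst' : (t.castSucc : Fin (L' + 1)).val = (s.castSucc : Fin (L' + 1)).val + 1 := by simp [hst]
    have hΨ := isHLExchange_vPsiVec (L := L' + 1) (n := n' + 1) hq hst'
    have hrel := vec_move_right hst' hΨ (σ := Fin.snoc σ' true) (by rw [Fin.snoc_castSucc]; exact hs) (by rw [Fin.snoc_castSucc]; exact ht)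
    rw [spinFlip_snoc hne] at hrel
    have hx : qbr (zv (s.castSucc : Fin (L' + 1)) / zv (t.castSucc : Fin (L' + 1))) ≠ 0 :=
      qbr_zv_div_ne_zero (fun h' => hne (Fin.castSucc_injective _ h'))
    apply mul_left_cancel₀ hx
    have hιs : genInv ℂ (L' + 1) (zv (s.castSucc : Fin (L' + 1))) = zv (s.castSucc : Fin (L' + 1)) := genInv_zv_of_ne (by simp; omega)
    have hιt : genInv ℂ (L' + 1) (zv (t.castSucc : Fin (L' + 1))) = zv (t.castSucc : Fin (L' + 1)) := genInv_zv_of_ne (by simp; omega)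
    have := congrArg (genInv ℂ (L' + 1)) hrel
    simp only [map_mul, map_sub, map_qbr, map_div₀, hιs, hιt, genInv_genC] at this
    rw [show (s.castSucc : Fin (L' + 1)).val + 1 = s.val + 1 by simp, genInv_genSwap_of_lt (by omega), ih, map_mul, map_pow,
      genSwap_zv_last (by omega)] at this
    rw [mul_left_comm, this, hrel, show (s.castSucc : Fin (L' + 1)).val + 1 = s.val + 1 by simp]
    ring

end RightDown

end Literature.Probability.Percolation
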